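import Summits.QuantumFields.YangMills.Theorems.FluctuationComparisonRegPrIntLS2BetaResidualGauge
import Literature.MathematicalPhysics.QuantumFieldTheory.Balaban1983to89.B12RTGaugeInvariance254
import HarnessLib

/-!
# (RG-K) The residual gauge group as a `Subgroup` — LIMIT's `K` with its instance and action rows

Third file of the RG-K letters for LINE g18-1 `Cruxes/FluctuationComparisonRegPrIntL/Lines/semiclassical_s2beta.lean` v6 (crux
`stmt-QuantumFields-20520`; LINE OWNER WORDS 6–8).  The ONE definition of the series: `residualSubgroup F hJK`, the `Subgroup` of
`SU(2)^{sites}` whose carrier is v6's `ResidualGauge F hJK` token for token (`coe_residualSubgroup` is `rfl`).  With it the type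
`↥(residualSubgroup F hJK)` carries `Group`, `IsTopologicalGroup`, `FirstCountableTopology`, `MeasurableSpace`, `BorelSpace` by Mathlib's
subtype instances, and this file supplies the remaining binders of
`Literature.Analysis.Asymptotics.LaplaceMethodOrbitCompact.tendsto_laplaceMethod_orbit_indicator_of_continuous` on the group side:
`[CompactSpace K]` (`compactSpace_residualSubgroup`, from ✓`isCompact_residualGauge`), `hact` (`continuous_gaugeAct_prod`), `hmul`
(`gaugeAct_mul`), `hone` (`gaugeAct_one`) and `hpres` (`measurePreserving_gaugeAct_residual`, lit
✓`B12RTGaugeInvariance254.measurePreserving_gaugeAct` by name); plus the infimum over the subgroup-subtype = the infimum over the v6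
set-subtype (`iInf_subtype_residualSubgroup`, `rfl`), so the ORB/GAP letters of `…ResidualGaugeOrbit` read verbatim on `K`; and (§4,
the (β″) carrier of w5-20520 g13's LIMIT-INST seam table) the ENLARGED group `↥(residualSubgroup F hJK) × (C → SU(2))` acting by
`pivotAct ι` along a pivot map `ι : C → bonds` (`ι := iterCentralBond (K−J)` at the consumer): residual factor by the gauge formula off
the pivots, pivot factor by LEFT translation on them — `hact`∕`hmul`∕`hone`∕`hpres` for THAT action (`continuous_pivotAct`,
`pivotAct_mul`, `pivotAct_one`, `measurePreserving_pivotAct`); §5 the sheet ∕ stabiliser letters for `hstab` ∕ `hfix`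
(`const_mem_residualSubgroup_of_comm`, `pivotAct_const_sheet_eq_self`, `pivotAct_eq_self_iff`) and the pivot-blindness seam
(`extend_pivotAct_eq`).

LEAN NOTE for LIMIT's hand: `GaugeTransf`/`GaugeField` are plain `def`s; state `K`-rows over `Site (F.P K) 0 → SU(2)` (Π-instances) and
prove joint continuity by `continuous_pi` directly — composing `T3OrbitAverage.continuous_gaugeAct_uncurry` at the product domain, or
leaving a metavariable under a `Finset.sum` over `PBond (F.P K) 0`, triggers `whnf` heartbeat time-outs (unfolding of the torus `Fintype`s).

HONEST: packaging only; this file proves NO stub of the line — EXW, GAP♯, LAPLACE (CHART∞ ∕ LIMIT ∕ KNIT ∕ DECAY), H4ᶜ, LFR♯ᶜ, S2β and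
crux 20520 stay OPEN; rung R3 (YM₃ on T³) is NOT d = 4, NOT infinite volume, NOT a mass gap, NOT Clay; the Yang–Mills mass gap is NOT
proved.
-/

noncomputable section

open MeasureTheory Filter Topology Set
open Literature.MathematicalPhysics.QuantumFieldTheory.Balaban1983to89
open Literature.MathematicalPhysics.QuantumFieldTheory.Balaban1983to89.T3ContinuumYM3Torus
open Literature.MathematicalPhysics.QuantumFieldTheory.Balaban1983to89.T3UnitLawDensityEML
open Literature.MathematicalPhysics.QuantumFieldTheory.Balaban1983to89.T3TiltDescent
open scoped Literature.MathematicalPhysics.QuantumFieldTheory.Balaban1983to89.T3OrbitAverage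
open Summit.QuantumFields.YangMills.Theorems.FluctuationComparisonRegPrIntLS2BetaResidualGauge

namespace Summit.QuantumFields.YangMills.Theorems.FluctuationComparisonRegPrIntLS2BetaResidualSubgroup

variable (F : T3Family) {J K : ℕ} (hJK : J ≤ K)

/-! ## §1 The subgroup -/

/-- **THE RESIDUAL GAUGE GROUP OF THE `(K−J)`-FOLD AVERAGING FIBRATION AS A SUBGROUP OF `SU(2)^{sites}`**: the fine gauge
transformations `w` of run `K` that act trivially on data, `D_{J,K}(U^w) = D_{J,K}(U)` for every fine `U`.  The carrier is the v6 Cruxes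
set `ResidualGauge F hJK` of `Lines/semiclassical_s2beta.lean` token for token; closure under `1, *, ⁻¹` = ✓`residual_one`,
✓`residual_mul`, ✓`residual_inv` (print: «These transformations form a group»).
[cite: Balaban1987RG1, p.256 (three sentences after (0.21)); Balaban1985Variational, (4) p.278] -/
def residualSubgroup : Subgroup (Site (F.P K) 0 → Matrix.specialUnitaryGroup (Fin 2) ℂ) where
  carrier := {w | ∀ U : GaugeField (F.P K) 0 (Matrix.specialUnitaryGroup (Fin 2) ℂ),
    descendTo F ℰp J K hJK (GaugeField.gaugeAct w U) = descendTo F ℰp J K hJK U}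
  mul_mem' hu hv := residual_mul F hJK hu hv
  one_mem' := residual_one F hJK
  inv_mem' hu := residual_inv F hJK hu

/-- Membership in the residual subgroup, unfolded: `D_{J,K}(U^w) = D_{J,K}(U)` for every fine `U` (the v6 text of `ResidualGauge`).
[cite: Balaban1987RG1, p.256 (three sentences after (0.21))] -/
theorem mem_residualSubgroup_iff {w : Site (F.P K) 0 → Matrix.specialUnitaryGroup (Fin 2) ℂ} :
    w ∈ residualSubgroup F hJK ↔ ∀ U : GaugeField (F.P K) 0 (Matrix.specialUnitaryGroup (Fin 2) ℂ),
      descendTo F ℰp J K hJK (GaugeField.gaugeAct w U) = descendTo F ℰp J K hJK U :=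
  Iff.rfl

/-- The carrier of the residual subgroup IS the v6 set `ResidualGauge F hJK` (definitionally; the docking equation).
[cite: Balaban1985Variational, (4) p.278] -/
theorem coe_residualSubgroup :
    (residualSubgroup F hJK : Set (Site (F.P K) 0 → Matrix.specialUnitaryGroup (Fin 2) ℂ)) =
      {w | ∀ U : GaugeField (F.P K) 0 (Matrix.specialUnitaryGroup (Fin 2) ℂ),
        descendTo F ℰp J K hJK (GaugeField.gaugeAct w U) = descendTo F ℰp J K hJK U} :=
  rfl

/-- An infimum over the subgroup-subtype IS the infimum over the v6 set-subtype (definitionally) — so GAP♯'s `⨅ w : ResidualGauge F hJK`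
and the ORB/GAP letters of `…ResidualGaugeOrbit` read verbatim on `↥(residualSubgroup F hJK)`. [cite: Balaban1985Variational, (10) p.279] -/
theorem iInf_subtype_residualSubgroup (f : (Site (F.P K) 0 → Matrix.specialUnitaryGroup (Fin 2) ℂ) → ℝ) :
    (⨅ w : residualSubgroup F hJK, f w) =
      ⨅ w : {w : Site (F.P K) 0 → Matrix.specialUnitaryGroup (Fin 2) ℂ |
          ∀ U : GaugeField (F.P K) 0 (Matrix.specialUnitaryGroup (Fin 2) ℂ),
            descendTo F ℰp J K hJK (GaugeField.gaugeAct w U) = descendTo F ℰp J K hJK U}, f w :=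
  rfl

/-! ## §2 The instance row `[CompactSpace K]` -/

/-- The residual subgroup is closed in `SU(2)^{sites}`. [cite: Balaban1987RG1, p.256 (three sentences after (0.21))] -/
theorem isClosed_residualSubgroup :
    IsClosed (residualSubgroup F hJK : Set (Site (F.P K) 0 → Matrix.specialUnitaryGroup (Fin 2) ℂ)) :=
  isClosed_residualGauge F hJK

/-- `↥(residualSubgroup F hJK)` is a compact space — the `[CompactSpace K]` binder of
`Literature.Analysis.Asymptotics.LaplaceMethodOrbitCompact.tendsto_laplaceMethod_orbit_indicator_of_continuous` (use as `haveI`; the other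
instance binders `IsTopologicalGroup`, `FirstCountableTopology`, `MeasurableSpace`, `BorelSpace` are found by instance search on the subtype).
[cite: Balaban1987RG1, p.256 (three sentences after (0.21))] -/
theorem compactSpace_residualSubgroup : CompactSpace (residualSubgroup F hJK) :=
  compactSpace_residualGauge F hJK

/-! ## §3 The action rows `hact`, `hmul`, `hone`, `hpres` -/

/-- `hact`: the residual subgroup acts JOINTLY CONTINUOUSLY on the fine fields `SU(2)^{bonds}`. [cite: Balaban1985Averaging, (8) p.19] -/
theorem continuous_gaugeAct_prod :
    Continuous fun p : residualSubgroup F hJK × GaugeField (F.P K) 0 (Matrix.specialUnitaryGroup (Fin 2) ℂ) =>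
      GaugeField.gaugeAct (p.1 : Site (F.P K) 0 → Matrix.specialUnitaryGroup (Fin 2) ℂ) p.2 := by
  refine continuous_pi fun b => ?_
  have hval : Continuous fun p : residualSubgroup F hJK × GaugeField (F.P K) 0 (Matrix.specialUnitaryGroup (Fin 2) ℂ) =>
      (p.1 : Site (F.P K) 0 → Matrix.specialUnitaryGroup (Fin 2) ℂ) :=
    continuous_subtype_val.comp continuous_fst
  show Continuous fun p : residualSubgroup F hJK × GaugeField (F.P K) 0 (Matrix.specialUnitaryGroup (Fin 2) ℂ) =>
      (p.1 : Site (F.P K) 0 → Matrix.specialUnitaryGroup (Fin 2) ℂ) b.src * p.2 b *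
        ((p.1 : Site (F.P K) 0 → Matrix.specialUnitaryGroup (Fin 2) ℂ) b.tgt)⁻¹
  exact (((continuous_apply b.src).comp hval).mul
    ((show Continuous fun U : GaugeField (F.P K) 0 (Matrix.specialUnitaryGroup (Fin 2) ℂ) => U b from
      continuous_apply b).comp continuous_snd)).mul ((continuous_apply b.tgt).comp hval).inv

/-- `hmul`: the action is multiplicative. [cite: Balaban1985Averaging, (8) p.19] -/
theorem gaugeAct_mul (k k' : residualSubgroup F hJK) (U : GaugeField (F.P K) 0 (Matrix.specialUnitaryGroup (Fin 2) ℂ)) :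
    GaugeField.gaugeAct ((k * k' : residualSubgroup F hJK) : Site (F.P K) 0 → Matrix.specialUnitaryGroup (Fin 2) ℂ) U =
      GaugeField.gaugeAct (k : Site (F.P K) 0 → Matrix.specialUnitaryGroup (Fin 2) ℂ)
        (GaugeField.gaugeAct (k' : Site (F.P K) 0 → Matrix.specialUnitaryGroup (Fin 2) ℂ) U) := by
  rw [Subgroup.coe_mul]
  exact gaugeAct_mul_eq _ _ U

/-- `hone`: the unit acts trivially. [cite: Balaban1985Averaging, (8) p.19] -/
theorem gaugeAct_one (U : GaugeField (F.P K) 0 (Matrix.specialUnitaryGroup (Fin 2) ℂ)) :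
    GaugeField.gaugeAct ((1 : residualSubgroup F hJK) : Site (F.P K) 0 → Matrix.specialUnitaryGroup (Fin 2) ℂ) U = U := by
  rw [Subgroup.coe_one]
  exact B12RTGaugeInvariance254.gaugeAct_one' U

/-- `hpres`: every residual transformation PRESERVES PRODUCT HAAR on `SU(2)^{bonds}` (lit `measurePreserving_gaugeAct`, by name).
[cite: Balaban1987RG1, p.254 (sentence on invariance of (0.13))] -/
theorem measurePreserving_gaugeAct_residual (k : residualSubgroup F hJK) :
    MeasurePreserving (GaugeField.gaugeAct (k : Site (F.P K) 0 → Matrix.specialUnitaryGroup (Fin 2) ℂ))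
      (fieldMeasure (F.P K) 0 (Matrix.specialUnitaryGroup (Fin 2) ℂ)) (fieldMeasure (F.P K) 0 (Matrix.specialUnitaryGroup (Fin 2) ℂ)) :=
  B12RTGaugeInvariance254.measurePreserving_gaugeAct _

/-- `hfinv` for `f := wilsonAction4`: the Wilson action is invariant under the residual subgroup. [cite: Balaban1985Variational, (1) p.278] -/
theorem wilsonAction4_gaugeAct_residual (k : residualSubgroup F hJK) (U : GaugeField (F.P K) 0 (Matrix.specialUnitaryGroup (Fin 2) ℂ)) :
    wilsonAction4 (GaugeField.gaugeAct (k : Site (F.P K) 0 → Matrix.specialUnitaryGroup (Fin 2) ℂ) U) = wilsonAction4 U :=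
  wilsonAction4_gaugeAct F (k : Site (F.P K) 0 → Matrix.specialUnitaryGroup (Fin 2) ℂ) U

/-- The residual subgroup preserves every fibre of the descent (so the action restricts to each fibre). [cite: Balaban1985Variational, (4) p.278] -/
theorem gaugeAct_mem_fibre_iff (k : residualSubgroup F hJK) (U : GaugeField (F.P K) 0 (Matrix.specialUnitaryGroup (Fin 2) ℂ))
    (V : GaugeField (F.P J) 0 (Matrix.specialUnitaryGroup (Fin 2) ℂ)) :
    GaugeField.gaugeAct (k : Site (F.P K) 0 → Matrix.specialUnitaryGroup (Fin 2) ℂ) U ∈ T3ConstrainedMinimiser.fibre F ℰp J K hJK V ↔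
      U ∈ T3ConstrainedMinimiser.fibre F ℰp J K hJK V :=
  gaugeAct_mem_fibre_iff_of_residual F hJK k.2 U V

/-- The residual subgroup preserves the UV-small-history events `histGood` (so `1_{histGood}`-type amplitudes are invariant).
[cite: Balaban1985UV3, (7) p.257] -/
theorem gaugeAct_mem_histGood_iff_residual (k : residualSubgroup F hJK) (θ : ℕ → ℝ) (n : ℕ)
    (U : GaugeField (F.P K) 0 (Matrix.specialUnitaryGroup (Fin 2) ℂ)) :
    GaugeField.gaugeAct (k : Site (F.P K) 0 → Matrix.specialUnitaryGroup (Fin 2) ℂ) U ∈ T3UnitScaleTilt.histGood F ℰp θ K n ↔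
      U ∈ T3UnitScaleTilt.histGood F ℰp θ K n :=
  gaugeAct_mem_histGood_iff F (k : Site (F.P K) 0 → Matrix.specialUnitaryGroup (Fin 2) ℂ) θ n U


/-! ## §4 (β″) The enlarged group `K × SU(2)^{pivots}` and its action `pivotAct` (LIMIT-INST's `act`; w5-20520 g13 seam table) -/

section PivotAct

variable {C : Type*} (ι : C → PBond (F.P K) 0)

/-- **THE (β″) ACTION OF `↥(residualSubgroup F hJK) × (C → SU(2))` ON THE FINE FIELDS** along a pivot map `ι : C → bonds`
(instantiate `ι := iterCentralBond (K−J)`): the residual factor acts by the gauge formula OFF the pivots, the pivot factor by LEFT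
translation `z(ι c) ↦ h c · z(ι c)` ON them.  A left action of the DIRECT product (`pivotAct_mul`, `pivotAct_one`), jointly continuous
(`continuous_pivotAct`), product-Haar preserving (`measurePreserving_pivotAct`); pivot-blind maps read `gaugeAct ↑k.1 z` through it
(`pivotAct_apply_of_not_mem_range`). [cite: Balaban1985Averaging, (8) p.19; Balaban1987RG1, p.254 (sentence on invariance of (0.13))] -/
def pivotAct (k : residualSubgroup F hJK × (C → Matrix.specialUnitaryGroup (Fin 2) ℂ))
    (z : GaugeField (F.P K) 0 (Matrix.specialUnitaryGroup (Fin 2) ℂ)) : GaugeField (F.P K) 0 (Matrix.specialUnitaryGroup (Fin 2) ℂ) :=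
  Function.extend ι (fun c => k.2 c * z (ι c)) (GaugeField.gaugeAct (k.1 : Site (F.P K) 0 → Matrix.specialUnitaryGroup (Fin 2) ℂ) z)

/-- ON a pivot (injective `ι`): left translation of that entry. [cite: Balaban1985Averaging, (8) p.19] -/
theorem pivotAct_apply_pivot (hι : Function.Injective ι) (k : residualSubgroup F hJK × (C → Matrix.specialUnitaryGroup (Fin 2) ℂ))
    (z : GaugeField (F.P K) 0 (Matrix.specialUnitaryGroup (Fin 2) ℂ)) (c : C) :
    pivotAct F hJK ι k z (ι c) = k.2 c * z (ι c) :=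
  hι.extend_apply _ _ c

/-- OFF the pivots: the gauge formula of the residual factor (what pivot-blind consumers read). [cite: Balaban1985Averaging, (8) p.19] -/
theorem pivotAct_apply_of_not_mem_range (k : residualSubgroup F hJK × (C → Matrix.specialUnitaryGroup (Fin 2) ℂ))
    (z : GaugeField (F.P K) 0 (Matrix.specialUnitaryGroup (Fin 2) ℂ)) {b : PBond (F.P K) 0} (hb : ¬ ∃ c, ι c = b) :
    pivotAct F hJK ι k z b = GaugeField.gaugeAct (k.1 : Site (F.P K) 0 → Matrix.specialUnitaryGroup (Fin 2) ℂ) z b :=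
  Function.extend_apply' _ _ b hb

/-- `hone` for the enlarged group. [cite: Balaban1985Averaging, (8) p.19] -/
theorem pivotAct_one (z : GaugeField (F.P K) 0 (Matrix.specialUnitaryGroup (Fin 2) ℂ)) : pivotAct F hJK ι 1 z = z := by
  classical
  funext b
  rw [pivotAct, Function.extend_def]
  split_ifs with h
  · rw [Prod.snd_one, Pi.one_apply, one_mul, Classical.choose_spec h]
  · rw [Prod.fst_one, Subgroup.coe_one]
    exact congrFun (B12RTGaugeInvariance254.gaugeAct_one' z) b

/-- `hmul` for the enlarged group (injective `ι`): OFF the pivots `gaugeAct` at a bond reads only that bond, ON them left translations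
compose. [cite: Balaban1985Averaging, (8) p.19] -/
theorem pivotAct_mul (hι : Function.Injective ι) (k k' : residualSubgroup F hJK × (C → Matrix.specialUnitaryGroup (Fin 2) ℂ))
    (z : GaugeField (F.P K) 0 (Matrix.specialUnitaryGroup (Fin 2) ℂ)) :
    pivotAct F hJK ι (k * k') z = pivotAct F hJK ι k (pivotAct F hJK ι k' z) := by
  funext b
  by_cases hb : ∃ c, ι c = b
  · obtain ⟨c, rfl⟩ := hb
    rw [pivotAct_apply_pivot F hJK ι hι, pivotAct_apply_pivot F hJK ι hι, pivotAct_apply_pivot F hJK ι hι, Prod.snd_mul,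
      Pi.mul_apply, mul_assoc]
  · rw [pivotAct_apply_of_not_mem_range F hJK ι _ _ hb, pivotAct_apply_of_not_mem_range F hJK ι _ _ hb, Prod.fst_mul,
      Subgroup.coe_mul]
    show ((k.1 : Site (F.P K) 0 → Matrix.specialUnitaryGroup (Fin 2) ℂ) * (k'.1 : Site (F.P K) 0 → Matrix.specialUnitaryGroup (Fin 2) ℂ))
        b.src * z b * (((k.1 : Site (F.P K) 0 → Matrix.specialUnitaryGroup (Fin 2) ℂ) *
          (k'.1 : Site (F.P K) 0 → Matrix.specialUnitaryGroup (Fin 2) ℂ)) b.tgt)⁻¹ =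
      (k.1 : Site (F.P K) 0 → Matrix.specialUnitaryGroup (Fin 2) ℂ) b.src * pivotAct F hJK ι k' z b *
        ((k.1 : Site (F.P K) 0 → Matrix.specialUnitaryGroup (Fin 2) ℂ) b.tgt)⁻¹
    rw [pivotAct_apply_of_not_mem_range F hJK ι _ _ hb]
    show _ = (k.1 : Site (F.P K) 0 → Matrix.specialUnitaryGroup (Fin 2) ℂ) b.src *
      ((k'.1 : Site (F.P K) 0 → Matrix.specialUnitaryGroup (Fin 2) ℂ) b.src * z b *
        ((k'.1 : Site (F.P K) 0 → Matrix.specialUnitaryGroup (Fin 2) ℂ) b.tgt)⁻¹) *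
      ((k.1 : Site (F.P K) 0 → Matrix.specialUnitaryGroup (Fin 2) ℂ) b.tgt)⁻¹
    simp only [Pi.mul_apply, mul_inv_rev, mul_assoc]

/-- `hact` for the enlarged group: `pivotAct` is jointly continuous (bondwise: a left translation or the gauge formula).
[cite: Balaban1985Averaging, (8) p.19] -/
theorem continuous_pivotAct :
    Continuous fun p : (residualSubgroup F hJK × (C → Matrix.specialUnitaryGroup (Fin 2) ℂ)) ×
        GaugeField (F.P K) 0 (Matrix.specialUnitaryGroup (Fin 2) ℂ) => pivotAct F hJK ι p.1 p.2 := by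
  classical
  refine continuous_pi fun b => ?_
  by_cases hb : ∃ c, ι c = b
  · have h : (fun p : (residualSubgroup F hJK × (C → Matrix.specialUnitaryGroup (Fin 2) ℂ)) ×
        GaugeField (F.P K) 0 (Matrix.specialUnitaryGroup (Fin 2) ℂ) => pivotAct F hJK ι p.1 p.2 b) =
        fun p => p.1.2 (Classical.choose hb) * p.2 (ι (Classical.choose hb)) := by
      funext p
      rw [pivotAct, Function.extend_def, dif_pos hb]
    rw [h]
    exact ((continuous_apply _).comp (continuous_snd.comp continuous_fst)).mul
      ((show Continuous fun U : GaugeField (F.P K) 0 (Matrix.specialUnitaryGroup (Fin 2) ℂ) => U (ι (Classical.choose hb)) from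
        continuous_apply _).comp continuous_snd)
  · have h : (fun p : (residualSubgroup F hJK × (C → Matrix.specialUnitaryGroup (Fin 2) ℂ)) ×
        GaugeField (F.P K) 0 (Matrix.specialUnitaryGroup (Fin 2) ℂ) => pivotAct F hJK ι p.1 p.2 b) =
        fun p => (p.1.1 : Site (F.P K) 0 → Matrix.specialUnitaryGroup (Fin 2) ℂ) b.src * p.2 b *
          ((p.1.1 : Site (F.P K) 0 → Matrix.specialUnitaryGroup (Fin 2) ℂ) b.tgt)⁻¹ := by
      funext p
      rw [pivotAct, Function.extend_apply' _ _ b hb]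
      rfl
    rw [h]
    have hval : Continuous fun p : (residualSubgroup F hJK × (C → Matrix.specialUnitaryGroup (Fin 2) ℂ)) ×
        GaugeField (F.P K) 0 (Matrix.specialUnitaryGroup (Fin 2) ℂ) => (p.1.1 : Site (F.P K) 0 → Matrix.specialUnitaryGroup (Fin 2) ℂ) :=
      continuous_subtype_val.comp (continuous_fst.comp continuous_fst)
    exact (((continuous_apply b.src).comp hval).mul
      ((show Continuous fun U : GaugeField (F.P K) 0 (Matrix.specialUnitaryGroup (Fin 2) ℂ) => U b from
        continuous_apply b).comp continuous_snd)).mul ((continuous_apply b.tgt).comp hval).inv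

/-- `hpres` for the enlarged group: `pivotAct ι k` PRESERVES PRODUCT HAAR (it is a bondwise left multiplication followed by a bondwise
right multiplication; lit `AveragingRT.measurePreserving_mulLeft` ∕ `…_mulRight`). [cite: Balaban1987RG1, p.254 (sentence on invariance of (0.13))] -/
theorem measurePreserving_pivotAct (k : residualSubgroup F hJK × (C → Matrix.specialUnitaryGroup (Fin 2) ℂ)) :
    MeasurePreserving (pivotAct F hJK ι k)
      (fieldMeasure (F.P K) 0 (Matrix.specialUnitaryGroup (Fin 2) ℂ)) (fieldMeasure (F.P K) 0 (Matrix.specialUnitaryGroup (Fin 2) ℂ)) := by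
  classical
  let L : PBond (F.P K) 0 → Matrix.specialUnitaryGroup (Fin 2) ℂ := fun b =>
    if h : ∃ c, ι c = b then k.2 (Classical.choose h) else (k.1 : Site (F.P K) 0 → Matrix.specialUnitaryGroup (Fin 2) ℂ) b.src
  let R : PBond (F.P K) 0 → Matrix.specialUnitaryGroup (Fin 2) ℂ := fun b =>
    if h : ∃ c, ι c = b then 1 else ((k.1 : Site (F.P K) 0 → Matrix.specialUnitaryGroup (Fin 2) ℂ) b.tgt)⁻¹
  have hfun : pivotAct F hJK ι k =
      (fun (U : GaugeField (F.P K) 0 (Matrix.specialUnitaryGroup (Fin 2) ℂ)) (b : PBond (F.P K) 0) => U b * R b) ∘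
        (fun (U : GaugeField (F.P K) 0 (Matrix.specialUnitaryGroup (Fin 2) ℂ)) (b : PBond (F.P K) 0) => L b * U b) := by
    funext z b
    simp only [Function.comp_apply]
    rw [pivotAct, Function.extend_def]
    by_cases h : ∃ c, ι c = b
    · rw [dif_pos h]
      simp only [L, R, dif_pos h, mul_one]
      rw [Classical.choose_spec h]
    · rw [dif_neg h]
      simp only [L, R, dif_neg h, GaugeField.gaugeAct]
  rw [hfun]
  exact (AveragingRT.measurePreserving_mulRight R).comp (AveragingRT.measurePreserving_mulLeft L)

/-- The enlarged group is compact (use as `haveI`; `Group`∕`IsTopologicalGroup`∕`MeasurableSpace`∕`BorelSpace` for the product come by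
instance search once `compactSpace_residualSubgroup` is in scope). [cite: Balaban1987RG1, p.256 (three sentences after (0.21))] -/
theorem compactSpace_residualSubgroup_prod :
    CompactSpace (residualSubgroup F hJK × (C → Matrix.specialUnitaryGroup (Fin 2) ℂ)) := by
  haveI := compactSpace_residualSubgroup F hJK
  infer_instance

end PivotAct


/-! ## §5 Sheets and stabiliser letters for `hstab` ∕ `hfix` and the pivot-blindness seam -/

section Sheets

open Literature.MathematicalPhysics.QuantumFieldTheory.Balaban1983to89.T3PrintedRegularOrbits
open Literature.MathematicalPhysics.QuantumFieldTheory.Balaban1983to89.T4Continuum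

variable {C : Type*} (ι : C → PBond (F.P K) 0)

/-- Restriction up the block centres of a CONSTANT gauge transformation is the same constant. [cite: Balaban1985Averaging, (12) p.19] -/
theorem descTransf_const (c : Matrix.specialUnitaryGroup (Fin 2) ℂ) :
    descTransf F J K hJK (fun _ => c) = fun _ => c := by
  funext x
  unfold descTransf
  suffices h : ∀ (k : ℕ) (y : Site (F.P K) k),
      transfUp (fun _ : Site (F.P K) 0 => c) k y = c from h _ _
  intro k
  induction k with
  | zero => intro y; rfl
  | succ k ih => intro y; exact ih (emb y)

/-- **THE CENTRAL-CONSTANT SHEETS ARE IN THE RESIDUAL SUBGROUP** (on `SU(2)`: `w ≡ ±1`). [cite: Balaban1985Variational, (4) p.278] -/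
theorem const_mem_residualSubgroup_of_comm {c : Matrix.specialUnitaryGroup (Fin 2) ℂ}
    (hc : ∀ g : Matrix.specialUnitaryGroup (Fin 2) ℂ, c * g = g * c) :
    (fun _ => c) ∈ residualSubgroup F hJK :=
  residual_of_descTransf_eq_const F hJK hc (descTransf_const F hJK c)

/-- `hfix`-letter: a central-constant sheet paired with the trivial pivot element FIXES EVERY fine field under `pivotAct`.
[cite: Balaban1985Averaging, (8) p.19] -/
theorem pivotAct_const_sheet_eq_self {c : Matrix.specialUnitaryGroup (Fin 2) ℂ}
    (hc : ∀ g : Matrix.specialUnitaryGroup (Fin 2) ℂ, c * g = g * c) (z : GaugeField (F.P K) 0 (Matrix.specialUnitaryGroup (Fin 2) ℂ)) :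
    pivotAct F hJK ι (⟨fun _ => c, const_mem_residualSubgroup_of_comm F hJK hc⟩, 1) z = z := by
  classical
  funext b
  rw [pivotAct, Function.extend_def]
  split_ifs with h
  · show (1 : C → Matrix.specialUnitaryGroup (Fin 2) ℂ) (Classical.choose h) * z (ι (Classical.choose h)) = z b
    rw [Pi.one_apply, one_mul, Classical.choose_spec h]
  · exact congrFun (gaugeAct_const_of_comm hc z) b

/-- **PIVOT-BLINDNESS SEAM**: a map that overwrites the pivot entries (`Function.extend ι g ·`, the shape of WREG's `Φ_V`) sees only the
gauge factor of `pivotAct`. [cite: Balaban1985Averaging, (8) p.19] -/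
theorem extend_pivotAct_eq (g : C → Matrix.specialUnitaryGroup (Fin 2) ℂ)
    (k : residualSubgroup F hJK × (C → Matrix.specialUnitaryGroup (Fin 2) ℂ)) (z : GaugeField (F.P K) 0 (Matrix.specialUnitaryGroup (Fin 2) ℂ)) :
    Function.extend ι g (pivotAct F hJK ι k z) =
      Function.extend ι g (GaugeField.gaugeAct (k.1 : Site (F.P K) 0 → Matrix.specialUnitaryGroup (Fin 2) ℂ) z) := by
  classical
  funext b
  rw [Function.extend_def, Function.extend_def]
  split_ifs with h
  · rfl
  · exact pivotAct_apply_of_not_mem_range F hJK ι k z h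

/-- **THE STABILISER SPLITS** (injective `ι`): `pivotAct ι k z = z` iff the pivot element is trivial AND the residual factor fixes `z` OFF
the pivots (the two factors touch disjoint coordinates) — the group half of `hstab`; the off-pivot half («a residual `w` fixing `z` off the
pivots is a central sheet») is the chart side's freeness. [cite: Balaban1985Variational, Thm 1 (10) p.279] -/
theorem pivotAct_eq_self_iff (hι : Function.Injective ι) (k : residualSubgroup F hJK × (C → Matrix.specialUnitaryGroup (Fin 2) ℂ))
    (z : GaugeField (F.P K) 0 (Matrix.specialUnitaryGroup (Fin 2) ℂ)) :
    pivotAct F hJK ι k z = z ↔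
      k.2 = 1 ∧ ∀ b : PBond (F.P K) 0, (¬ ∃ c, ι c = b) →
        GaugeField.gaugeAct (k.1 : Site (F.P K) 0 → Matrix.specialUnitaryGroup (Fin 2) ℂ) z b = z b := by
  constructor
  · intro h
    refine ⟨funext fun c => ?_, fun b hb => ?_⟩
    · have hc := congrFun h (ι c)
      rw [pivotAct_apply_pivot F hJK ι hι] at hc
      exact mul_right_cancel (hc.trans (one_mul _).symm)
    · have hb' := congrFun h b
      rwa [pivotAct_apply_of_not_mem_range F hJK ι k z hb] at hb'
  · rintro ⟨h2, hoff⟩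
    funext b
    by_cases hb : ∃ c, ι c = b
    · obtain ⟨c, rfl⟩ := hb
      rw [pivotAct_apply_pivot F hJK ι hι, h2, Pi.one_apply, one_mul]
    · rw [pivotAct_apply_of_not_mem_range F hJK ι k z hb]
      exact hoff b hb

end Sheets

end Summit.QuantumFields.YangMills.Theorems.FluctuationComparisonRegPrIntLS2BetaResidualSubgroup

end
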